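import Summits.ResolutionOfSingularities.ResolutionOfSingularities.Theorems.EquisingularLiftEquisingularLiftNatNDStrataTower
import Summits.ResolutionOfSingularities.ResolutionOfSingularities.Theorems.FrobeniusClosingPatchingRelPerfectDepthSNCPointwise
import Literature.AlgebraicGeometry.Resolution.MarkedIdeals
import HarnessLib

/-!
# [OURS · L1 W4.5(b) · EL♮(3)] PORT DRAFT for lead-2's `Theorems/…NatNDSNCInv.lean` (desk ruling 2026-08-28T14:06:05Z): the O-side candidate invariant
# `SNCInv` = MERGED RE-CUT of record (027 U-free pointwise (b)(c) + stub-2 (A1)(A2)), VERBATIM from SPEC v7 §13.7 of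
# `Cruxes/EquisingularLiftNatThree/NewtonNondegenerateRungK5.lean`

OURS · counted 0 · AI-written (res-L1-w45b-idea-1 g23), weaker than expert review; nothing of [Hironaka2017] asserted; no statement of the manuscript.
One `def` (a `Prop`), no theorem, no `sorry`, no instance, no notation. Namespace `…Cruxes.EquisingularLiftNat.Sections.ND` (same as `…NatNDStrataTower`).
Clause owners close BY NAME against the ported decl: (B3a) `sncInv_init` (res-type-027), (B3g) `sncInv_stratumFacts` (stub-4), (B3b) `sncInv_stepFacts` (stub-2).
-/

set_option linter.dupNamespace false

noncomputable section

open CategoryTheory CategoryTheory.Limits AlgebraicGeometry TopologicalSpace Topology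
open Literature.AlgebraicGeometry.Resolution
open AlgebraicGeometry.Scheme.IdealSheafData

namespace Summit.ResolutionOfSingularities.ResolutionOfSingularities.Cruxes.EquisingularLiftNat.Sections.ND

variable {n : ℕ} (P : Scheme.{0}) (Y : Set P)

/-- **`SNCInv` (v7 = the desk's MERGED RE-CUT of record, 2026-08-28T14:06:05Z: 027's U-FREE POINTWISE (b)/(c) + stub-2's (A1)/(A2))** — «the model `jm`
is a closed immersion; the special fibre and the present boundary members have simple normal crossings AT EVERY POINT OF THE NON-FRAME EXCEPTIONAL SUPPORT,
the fibre's germ differing there from every member's germ; and the two floors' boundaries match under `jm`».  Data: a finite set `R` of PRESENT rays (no open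
`U` any more).  Clauses: (A1) `IsClosedImmersion jm` (stub-2: (B3b) computes `j'.ker = jm.ker.comap τX` from it, `StepFacts` carrying no `hθ`; (B3a) gets it
from `hθ` by `isClosedImmersion_of_isPullback`); (a) absent rays carry `⊤` on both floors; (b) every present NON-FRAME ray's upstairs divisor lies off the
generic point of `Y` (027: the «`supp ⊆ U`» half is gone with `U`); (c) at every point `y` of the non-frame exceptional support, `jm.ker :: present members` is
SNC AT `y` in the tree's pointwise predicate `Theorems.DepthSNC.SNCWithAt … ⊤ y` (`hasSNCWith_iff_sncWithAt`; transport under a step READY-MADE: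
`IsBlowup.sncWithAt_transform(_of_mem_support/_of_not_mem_support)`, `SNCWithAt.congr_mem`; this DELETES the former sub-brick (B3a-O) «SNC locus open»);
(c′) the fibre-vs-member guard in POINTWISE STALK form (stub-2 (A2), U-free; guarded like (c) by the non-frame exceptional support, which is where (B3g)
consumes it — stub-4 l.≈81306 (ii) — and where (B3b) must re-establish it; `SNCWithAt`'s injective labels live on SHEAVES, so the guard is exactly what
separates the fibre's label from a member's at a common point); (d) MODEL COMPATIBILITY verbatim as before: present non-frame rays EXACTLY, frame rays on
STALKS at the points of the downstairs exceptional locus.  Witness against the old GLOBAL guard (stub-2, desk l.≈81341): `U ∩ V(jm.ker) = ∅` after a step makes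
`EX₂ e₁|_U = ⊤ = fibre|_U`.  [OURS · L1 W4.5b · CANDIDATE definition, clause owners 027 (B3a) / stub-4 (B3g) / stub-2 (B3b); after the port, amendments go
by a successor def name] -/
def SNCInv (X : Scheme.{0}) (σ : X ⟶ P) (F : Scheme.{0}) (jm : F ⟶ X) (EX : Boundary n X) (E : Boundary n F) : Prop :=
  IsClosedImmersion jm ∧
  ∃ (R : Finset (Ray n)),
    -- (a) absent rays
    (∀ ρ, ρ ∉ R → EX ρ = ⊤ ∧ E ρ = ⊤) ∧
    -- (b) the upstairs exceptional divisors lie off the generic point of `Y`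
    (∀ ρ ∈ R, ρ ∉ Set.range (e n) → σ '' ((EX ρ).support : Set X) ⊆ {y : P | ¬ IsGenericPoint y Y}) ∧
    -- (c) SNC of «special fibre :: present members» AT EVERY POINT OF THE NON-FRAME EXCEPTIONAL SUPPORT
    (∀ y : X, (∃ ρ ∈ R, ρ ∉ Set.range (e n) ∧ y ∈ ((EX ρ).support : Set X)) →
      Summit.ResolutionOfSingularities.ResolutionOfSingularities.Theorems.DepthSNC.SNCWithAt
        (jm.ker :: (R.toList.map fun ρ => EX ρ)) ⊤ y) ∧
    -- (c′) there, the fibre's germ differs from every present member's germ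
    (∀ ρ ∈ R, ∀ y : X, (∃ ρ' ∈ R, ρ' ∉ Set.range (e n) ∧ y ∈ ((EX ρ').support : Set X)) →
      y ∈ (jm.ker.support : Set X) → y ∈ ((EX ρ).support : Set X) → stalkIdeal (EX ρ) y ≠ stalkIdeal jm.ker y) ∧
    -- (d) model compatibility of the two floors
    (∀ ρ ∈ R, ρ ∉ Set.range (e n) → (EX ρ).comap jm = E ρ) ∧
    (∀ (i : Fin n) (y : F), (∃ ρ ∈ R, ρ ∉ Set.range (e n) ∧ y ∈ ((E ρ).support : Set F)) →
      stalkIdeal ((EX (e n i)).comap jm) y = stalkIdeal (E (e n i)) y)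

end Summit.ResolutionOfSingularities.ResolutionOfSingularities.Cruxes.EquisingularLiftNat.Sections.ND
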